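import Summits.Ventures.CertifiedArithmetic.Expansions.CompressAdjacencyPrecThree
import Summits.Ventures.CertifiedArithmetic.Expansions.WeakExpansionNonoverlapping
import Mathlib.Tactic.Linarith
import Mathlib.Tactic.Positivity
import Mathlib.Tactic.Ring
import Mathlib.Tactic.NormNum

/-!
# COMPRESS returns a weakly nonoverlapping expansion under any tie rule (new work, p ≥ 3)

New work of the certified-arithmetic venture (ENGINES group: shared numerical engines serving
client cells; rigour lives in the verifiers; every published number belongs to a client cell's
ledger, not to the engines group).  Theorem 23 of [Shewchuk1997, §2.7]: for every
round-to-nearest, `h = COMPRESS(e)` is a nonoverlapping expansion of nonzero components with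
the sum of `e`, "nonadjacent if round-to-even is used" (the tree's `compress_spec`,
`compress_nonadjacent_roundTiesEven`).  Under other tie rules nonadjacency fails
(`CompressAdjacentTiesAway`: ties-to-away maps `⟨2^e₀, 2^p·2^e₀⟩` to the adjacent pair
`⟨−2^e₀, (2^p+2)·2^e₀⟩`).  THIS FILE, the sequel of `CompressAdjacencyInvariant.lean` and
`CompressAdjacencyPrecThree.lean`, proves for EVERY round-to-nearest map `fl` and every
precision `p ≥ 3` (the last two items for `p ≥ 4`):
* `compress_noDoubleAdj` — in `COMPRESS(e)` no component is adjacent to both neighbours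
  (`NoDoubleAdj`: every window of three consecutive components satisfies `NoDouble`) and the
  lower member of every adjacent consecutive pair is one-bit (`IsChain LowOneBit`): the upward
  sweep run with the invariant `AdjInv` beside Theorem 23's `UpInv 1` (`compressUp_noDoubleAdj`,
  an induction shaped exactly like the tree's `compressUp_spec`);
* `compress_isWeakExpansion` — hence `COMPRESS(e)` is WEAKLY NONOVERLAPPING (`IsWeakExpansion`,
  the venture's class W of `WeakExpansion.lean`: pairwise `WeakBelow`, triplewise `NoDouble`);
  windows and consecutive pairs control all pairs and triples because the components are
  nonzero and pairwise nonoverlapping (`isWeakExpansion_of_windows`, `below_two_of_between`);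
* `fastExpansionSum_compress_compress` — consequently, under ANY tie rule, FAST-EXPANSION-SUM of
  two COMPRESSED nonoverlapping expansions is a nonoverlapping expansion of floats with the
  exact sum: Theorem 1 of the class-W series (`fastExpansionSum_nonoverlapping_of_isWeakExpansion`,
  any round-to-nearest) applies to the compressed inputs.  So COMPRESS is a valid normaliser in
  front of FAST-EXPANSION-SUM even where Theorem 13's strongly nonoverlapping hypothesis and
  Theorem 23's nonadjacency clause both fail;
* `compressAccumulate_spec` — the loop "compress the summand, FAST-EXPANSION-SUM, compress the
  total" sums ANY list of nonoverlapping expansions exactly under ANY tie rule, class W being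
  the loop invariant (without the intermediate COMPRESS, FAST-EXPANSION-SUM can leave class W
  under ties-to-away: `WeakExpansion.lean`, evidence (b)).

HONEST FRAMING.  Nothing here is claimed by the paper, whose nonadjacency clause assumes
round-to-even; class W is the venture's notion, not Shewchuk's; `p ≥ 3` comes from the key step
of the invariant (`below_two_emit_of_adjacent_three_le`; at `p = 2` that step fails from an
unreachable sweep state and COMPRESS itself is not treated), `p ≥ 4` in the last two items from
Theorem 1 of the class-W series (`WeakExpansionNonoverlapping.lean`).
-/

namespace Summit.Ventures.CertifiedArithmetic.Expansions

open Literature.ComputerArithmetic.JeannerodRump2018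
open Literature.ComputerArithmetic.BoldoJeannerodMelquiondMuller2023 hiding twoSum twoSum_fst
  isFloat_twoSum
open Literature.ComputerArithmetic.Shewchuk1997

variable {p : ℕ} {emin : ℤ} {fl : ℚ → ℚ}

/-! ### The sweep and COMPRESS -/

/-- THE UPWARD SWEEP (Lines 10–16) emits no doubly adjacent window and only one-bit lower
members of adjacent pairs, for any round-to-nearest and `p ≥ 3`: induction over the `g`-list
exactly as in the tree's `compressUp_spec` (Theorem 23's invariant `UpInv 1` supplies floats,
magnitudes and the carry bounds; its carry estimate for the next step is repeated verbatim),
carrying `AdjInv` alongside; the final top `Q` closes the last window by the flag and the last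
pair by the head record. [cite: Shewchuk1997, Thm 23 p. 333 + Fig. 13] -/
theorem compressUp_noDoubleAdj (hp : 3 ≤ p) (hfl : IsRoundNearest p emin fl) :
    ∀ (gs : List ℚ) (Q : ℚ) (rs : List ℚ), UpInv p emin 1 rs Q → AdjInv p emin rs Q →
      (∀ g ∈ gs, IsFloat p emin g) → (∀ g ∈ gs, (2 : ℚ) ^ (emin + p) ≤ |g|) →
      UStair p emin (Q + rs.sum) gs → gs.IsChain (fun a b => |a| ≤ ulp p emin b) →
      (∀ g ∈ gs.head?, |Q| ≤ ulp p emin g) →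
      NoDoubleAdj (rs.reverse ++ compressUp fl Q gs) ∧
        (rs.reverse ++ compressUp fl Q gs).IsChain LowOneBit := by
  have hp1 : 1 ≤ p := by omega
  have hp2 : 2 ≤ p := by omega
  intro gs
  induction gs with
  | nil =>
    intro Q rs _ ainv _ _ _ _ _
    rw [compressUp_nil, show rs.reverse ++ [Q] = (Q :: rs).reverse by simp]
    refine ⟨(ainv.win.cons fun b c t hrs => ?_).reverse,
      List.isChain_reverse.mpr (List.isChain_cons.mpr ⟨fun r hr => ?_, ainv.low⟩)⟩
    · by_cases hbc : Below 2 c b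
      · exact Or.inl hbc
      · exact Or.inr (ainv.flag b c t hrs hbc)
    · obtain ⟨u, -, huQ, hr2, -⟩ := ainv.hd r hr
      exact lowOneBit_of_onGrid huQ hr2
  | cons g rest ih =>
    intro Q rs inv ainv hF hbig hst hch hQg
    have hg : IsFloat p emin g := hF g (by simp)
    have hgbig : (2 : ℚ) ^ (emin + p) ≤ |g| := hbig g (by simp)
    have hQg' : |Q| ≤ ulp p emin g := hQg g (by simp)
    have hF' : ∀ x ∈ rest, IsFloat p emin x := fun x hx => hF x (List.mem_cons_of_mem _ hx)
    have hbig' : ∀ x ∈ rest, (2 : ℚ) ^ (emin + p) ≤ |x| :=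
      fun x hx => hbig x (List.mem_cons_of_mem _ hx)
    obtain ⟨-, hst'⟩ := uStair_cons.mp hst
    obtain ⟨hgU, hch'⟩ := List.isChain_cons.mp hch
    have hg0 : g ≠ 0 := abs_pos.mp ((zpow_pos two_pos _).trans_le hgbig)
    have hQleg : |Q| ≤ |g| := hQg'.trans (ulp_le_abs_of_isFloat hg hg0)
    obtain ⟨h1, -, -, h4⟩ := fastTwoSum_exact hp1 hfl hg inv.hQ hQleg
    -- the carry bound for the next step (both cases: `x = fl(g + Q)` lies on the grid
    -- `ulp(g + Q) ≤ ulp y` and `|x + r| < ulp y` for the new emitted sum `r`)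
    have hnext : ∀ r : ℚ, |r| < ulp p emin (g + Q) →
        (fastTwoSum fl g Q).1 + r = Q + rs.sum + g →
        ∀ y ∈ rest.head?, |(fastTwoSum fl g Q).1| ≤ ulp p emin y := by
      intro r hr hS y hy
      have hgy : |g| ≤ ulp p emin y := hgU y hy
      have hT : |(fastTwoSum fl g Q).1 + r| < ulp p emin y := by
        rw [hS]; exact hst'.head_lt hy
      obtain ⟨u, hu, hU⟩ := exists_ulp_eq_two_zpow (p := p) (emin := emin) y
      obtain ⟨k, -, hK⟩ := exists_ulp_eq_two_zpow (p := p) (emin := emin) (g + Q)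
      have hkQn : OnGrid k (fastTwoSum fl g Q).1 := by
        obtain ⟨K, hK'⟩ := exists_fl_eq_int_mul_ulp hp1 hfl (g + Q)
        exact ⟨K, by rw [h1, hK', hK]⟩
      have hku : k ≤ u := by
        have ht2 : |g + Q| ≤ 2 * (2 : ℚ) ^ u :=
          calc |g + Q| ≤ |g| + |Q| := abs_add_le _ _
            _ ≤ |g| + |g| := by linarith
            _ ≤ 2 * (2 : ℚ) ^ u := by rw [← hU]; linarith
        have := ulp_le_two_zpow_of_abs_le hp2 hu ht2
        rw [hK] at this
        exact (zpow_le_zpow_iff_right₀ (by norm_num : (1 : ℚ) < 2)).mp this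
      rw [hU]
      exact abs_le_two_zpow_of_onGrid hku hkQn (by rw [← hK]; exact hr) (by rw [← hU]; exact hT)
    by_cases hq : (fastTwoSum fl g Q).2 = 0
    · -- exact step
      obtain ⟨inv', hQnval, hge⟩ := inv.absorb hp2 hfl hg hgbig hQg' hq
      have hS : (fastTwoSum fl g Q).1 + rs.sum = Q + rs.sum + g := by rw [hQnval]; ring
      have hr : |rs.sum| < ulp p emin (g + Q) := by
        rw [← hQnval]; exact inv.sum_lt.trans_le (ulp_mono hge)
      rw [compressUp_cons_of_eq_zero hq]
      exact ih _ rs inv' (ainv.absorb hp2 hfl inv hg hgbig hQg' hq) hF' hbig'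
        (by rw [hS]; exact hst') hch' (hnext _ hr hS)
    · -- emitting step
      obtain ⟨inv', hbound⟩ :=
        inv.emit hp2 hfl le_rfl (roundoffBelow_one hp1 hfl) hg hgbig hQg' hq
      have hS : (fastTwoSum fl g Q).1 + ((fastTwoSum fl g Q).2 :: rs).sum = Q + rs.sum + g := by
        rw [List.sum_cons]; linarith [h4]
      rw [compressUp_cons_of_ne_zero hq, show rs.reverse ++ (fastTwoSum fl g Q).2 ::
          compressUp fl (fastTwoSum fl g Q).1 rest = ((fastTwoSum fl g Q).2 :: rs).reverse ++
          compressUp fl (fastTwoSum fl g Q).1 rest by simp]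
      exact ih _ _ inv' (ainv.emit_three_le hp hfl inv hg hgbig hQg' hq) hF' hbig'
        (by rw [hS]; exact hst') hch' (hnext _ (by rw [List.sum_cons]; exact hbound) hS)

/-- **WEAK NONADJACENCY OF COMPRESS, ANY TIE RULE** (`p ≥ 3`).  For every round-to-nearest map
`fl` and every nonoverlapping expansion `e` of floats, in `h = COMPRESS(e)` (increasing
magnitude) (i) no component is adjacent to both neighbours — of three consecutive components
`a, b, c`, `a` lies 2-below `b` or `b` lies 2-below `c` — and (ii) of two consecutive
components `a, b`, `a` lies 2-below `b` or `|a|` is a power of two.  Under round-to-even the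
stronger `compress_nonadjacent_roundTiesEven` (Theorem 23) holds; under ties-to-away adjacent
pairs with a non-one-bit upper member do occur (`CompressAdjacentTiesAway`), so (i)–(ii) is
what survives.  The downward sweep enters only through `compressDown_spec`.
[cite: Shewchuk1997, Thm 23 p. 331 + §2.4 (strongly nonoverlapping); BoldoEtAl2023, §2.1] -/
theorem compress_noDoubleAdj (hp : 3 ≤ p) (hfl : IsRoundNearest p emin fl) {e : List ℚ}
    (he : ∀ x ∈ e, IsFloat p emin x) (hexp : IsExpansion 1 e) :
    NoDoubleAdj (compress fl e) ∧ (compress fl e).IsChain LowOneBit := by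
  have hp2 : 2 ≤ p := by omega
  cases hrev : e.reverse with
  | nil =>
    have he0 : e = [] := by simpa using congrArg List.reverse hrev
    subst he0
    simp only [compress, List.reverse_nil]
    exact ⟨fun t₁ a b c t₂ h => absurd (congrArg List.length h) (by simp), List.IsChain.nil⟩
  | cons em rest =>
    have he' : e = rest.reverse ++ [em] := by simpa using congrArg List.reverse hrev
    have hcomp : compress fl e =
        compressUp fl (compressDown fl em rest).2 (compressDown fl em rest).1.reverse := by
      simp only [compress, hrev]
    rw [hcomp]
    subst he'
    have hem : IsFloat p emin em := he em (by simp)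
    have hrestF : ∀ y ∈ rest, IsFloat p emin y := fun y hy => he y (by simp [hy])
    have hexp' : IsExpansion 1 rest.reverse := hexp.sublist (List.sublist_append_left _ _)
    have hbel : ∀ y ∈ rest, Below 1 y em := fun y hy =>
      (List.pairwise_append.mp hexp).2.2 y (List.mem_reverse.mpr hy) em (by simp)
    have outd := compressDown_spec hp2 hfl rest em hem hrestF hexp' hbel
    generalize hgs : (compressDown fl em rest).1 = gs at *
    generalize hgb : (compressDown fl em rest).2 = gb at *
    have inv : UpInv p emin 1 [] gb :=
      ⟨by simp, outd.hgb, List.Pairwise.nil, by simp, by simp, by simpa using ulp_pos _⟩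
    have hst : UStair p emin (gb + ([] : List ℚ).sum) gs.reverse := by
      have h := uStair_reverse_of_dStair outd.stair
      rw [List.reverse_append, List.reverse_singleton, List.singleton_append, uStair_cons,
        zero_add] at h
      simpa using h.2
    have hch0 := List.isChain_reverse.mpr outd.chain
    rw [List.reverse_append, List.reverse_singleton, List.singleton_append,
      List.isChain_cons] at hch0
    have outu := compressUp_noDoubleAdj hp hfl gs.reverse gb [] inv (AdjInv.nil gb)
      (fun g hg => outd.floats g (List.mem_reverse.mp hg))
      (fun g hg => outd.big g (List.mem_reverse.mp hg)) hst hch0.2 hch0.1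
    rwa [List.reverse_nil, List.nil_append] at outu

/-! ### From windows and consecutive pairs to the class W -/

/-- Two nonoverlapping gaps across a NONZERO middle component make a nonadjacent gap: `x`
1-below `d`, `d` 1-below `y`, `d ≠ 0` give `x` 2-below `y` (`2^s ≤ |d| < 2^t` for the two
grids, so `y ∈ 2^(s+1)ℤ` and `2|x| < 2^(s+1)`). [cite: Shewchuk1997, §2.1 p. 309] -/
theorem below_two_of_between {x d y : ℚ} (hxd : Below 1 x d) (hdy : Below 1 d y) (hd : d ≠ 0) :
    Below 2 x y := by
  obtain ⟨s, hsd, hxs⟩ := hxd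
  obtain ⟨t, hty, hdt⟩ := hdy
  have hst : (2 : ℚ) ^ s < 2 ^ t := by linarith [hsd.two_zpow_le_abs hd]
  have hst' : s < t := (zpow_lt_zpow_iff_right₀ (by norm_num : (1 : ℚ) < 2)).mp hst
  exact ⟨s + 1, hty.mono (by omega), by rw [zpow_add_one₀ two_ne_zero]; linarith⟩

/-- Dropping the smallest component keeps the window condition. [cite: Shewchuk1997, §2.4] -/
theorem NoDoubleAdj.tail {x : ℚ} {l : List ℚ} (h : NoDoubleAdj (x :: l)) : NoDoubleAdj l :=
  fun t₁ a b c t₂ heq => h (x :: t₁) a b c t₂ (by rw [heq]; rfl)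

/-- **WINDOWS SUFFICE.**  A list of NONZERO, pairwise nonoverlapping components whose windows
of three consecutive components satisfy `NoDouble` and whose consecutive pairs satisfy
`LowOneBit` is weakly nonoverlapping: non-consecutive pairs and triples are nonadjacent
outright, across the nonzero component between them. [cite: Shewchuk1997, §2.4] -/
theorem isWeakExpansion_of_windows :
    ∀ {l : List ℚ}, l.Pairwise (Below 1) → (∀ x ∈ l, x ≠ 0) → NoDoubleAdj l →
      l.IsChain LowOneBit → IsWeakExpansion l
  | [], _, _, _, _ => isWeakExpansion_nil
  | [_], _, _, _, _ =>
    isWeakExpansion_cons.mpr ⟨by simp, List.Pairwise.nil, isWeakExpansion_nil⟩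
  | x :: d :: l, hpw, hnz, hwin, hch => by
    obtain ⟨hx, hpw'⟩ := List.pairwise_cons.mp hpw
    have hd : ∀ y ∈ l, Below 1 d y := (List.pairwise_cons.mp hpw').1
    obtain ⟨hxd, hch'⟩ := List.isChain_cons.mp hch
    have hd0 : d ≠ 0 := hnz d (by simp)
    have hxy : ∀ y ∈ l, Below 2 x y := fun y hy =>
      below_two_of_between (hx d (by simp)) (hd y hy) hd0
    have ih := isWeakExpansion_of_windows hpw' (fun y hy => hnz y (List.mem_cons_of_mem _ hy))
      hwin.tail hch'
    refine isWeakExpansion_cons.mpr ⟨fun y hy => ?_, List.pairwise_cons.mpr ⟨fun z hz => ?_,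
      (List.pairwise_cons.mp hpw').2.imp_of_mem fun ha _ _ => Or.inl (hxy _ ha)⟩, ih⟩
    · -- every later component is weakly above `x`
      rcases List.mem_cons.mp hy with rfl | hy
      · rcases hxd y (by simp) with h | h
        · exact Or.inl h
        · exact Or.inr ⟨hx y (by simp), h⟩
      · exact Or.inl (hxy y hy)
    · -- the triples `x, d, z`
      cases l with
      | nil => simp at hz
      | cons c l' =>
        rcases List.mem_cons.mp hz with rfl | hz'
        · exact hwin [] x d z l' rfl
        · exact Or.inr (below_two_of_between (hd c (by simp))
            ((List.pairwise_cons.mp (List.pairwise_cons.mp hpw').2).1 z hz') (hnz c (by simp)))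

/-- **COMPRESS RETURNS A WEAKLY NONOVERLAPPING EXPANSION, ANY TIE RULE** (`p ≥ 3`).  For every
round-to-nearest map `fl` and every nonoverlapping expansion `e` of floats, `COMPRESS(e)` lies
in the class W of `WeakExpansion.lean` (pairwise `WeakBelow`, triplewise `NoDouble`) — the
class of inputs on which FAST-EXPANSION-SUM is proved correct under any tie rule.  Theorem 23
gives nonoverlapping, nonzero components (`compress_nonoverlapping`); the invariant `AdjInv`
gives the windows and pairs (`compress_noDoubleAdj`); a single-component output is trivially
in W. [cite: Shewchuk1997, Thm 23 p. 331, §2.4; BoldoEtAl2023, §2.1] -/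
theorem compress_isWeakExpansion (hp : 3 ≤ p) (hfl : IsRoundNearest p emin fl) {e : List ℚ}
    (he : ∀ x ∈ e, IsFloat p emin x) (hexp : IsExpansion 1 e) :
    IsWeakExpansion (compress fl e) := by
  have out := compress_nonoverlapping (by omega) hfl he hexp
  rcases out.nz with hnz | hsingle
  · obtain ⟨hwin, hch⟩ := compress_noDoubleAdj hp hfl he hexp
    exact isWeakExpansion_of_windows out.exp hnz hwin hch
  · rw [hsingle]
    exact isWeakExpansion_cons.mpr ⟨by simp, List.Pairwise.nil, isWeakExpansion_nil⟩

/-- **COMPRESS NORMALISES FOR FAST-EXPANSION-SUM, ANY TIE RULE** (`p ≥ 4`).  For every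
round-to-nearest map `fl` and nonoverlapping expansions `e`, `f` of floats,
`FAST-EXPANSION-SUM(COMPRESS(e), COMPRESS(f))` is a nonoverlapping expansion of floats whose
sum is `Σ e + Σ f` exactly: Theorem 1 of the class-W series on the two compressed inputs, with
Theorem 23's exact sums.  (Under round-to-even Theorem 23's nonadjacent outputs already
qualify; the point is every OTHER tie rule, e.g. ties-to-away.)
[cite: Shewchuk1997, Thm 13 p. 321, Thm 23 p. 331] -/
theorem fastExpansionSum_compress_compress (hp : 4 ≤ p) (hfl : IsRoundNearest p emin fl)
    {e f : List ℚ} (he : ∀ x ∈ e, IsFloat p emin x) (hexp : IsExpansion 1 e)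
    (hf : ∀ x ∈ f, IsFloat p emin x) (hfxp : IsExpansion 1 f) :
    IsExpansion 1 (fastExpansionSum fl (compress fl e) (compress fl f)) ∧
      (fastExpansionSum fl (compress fl e) (compress fl f)).sum = e.sum + f.sum ∧
      ∀ x ∈ fastExpansionSum fl (compress fl e) (compress fl f), IsFloat p emin x := by
  have hp2 : 2 ≤ p := by omega
  have hp3 : 3 ≤ p := by omega
  have oe := compress_nonoverlapping hp2 hfl he hexp
  have of := compress_nonoverlapping hp2 hfl hf hfxp
  obtain ⟨h1, h2, -, h4⟩ := fastExpansionSum_nonoverlapping_of_isWeakExpansion hp hfl oe.floats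
    (compress_isWeakExpansion hp3 hfl he hexp) of.floats
    (compress_isWeakExpansion hp3 hfl hf hfxp)
  exact ⟨h1, by rw [h2, oe.sum_eq, of.sum_eq], h4⟩

/-! ### Accumulating many expansions under any tie rule -/

/-- ACCUMULATION BY FAST KERNELS UNDER ANY TIE RULE: sum a list of expansions by alternating
COMPRESS and FAST-EXPANSION-SUM — each summand is compressed (into class W), added to the
running total by FAST-EXPANSION-SUM (nonoverlapping output), and the total is compressed again
(back into class W, ready for the next summand). [cite: Shewchuk1997, §2.8 + Thm 13, Thm 23] -/
def compressAccumulate (fl : ℚ → ℚ) : List (List ℚ) → List ℚ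
  | [] => []
  | e :: es => compress fl (fastExpansionSum fl (compress fl e) (compressAccumulate fl es))

/-- **EXACT ACCUMULATION OF EXPANSIONS WITH THE FAST KERNELS, ANY TIE RULE** (`p ≥ 4`).  For
every round-to-nearest map `fl` (ties-to-away included) and every list of nonoverlapping
expansions of floats, `compressAccumulate` returns a weakly nonoverlapping expansion of floats
whose sum is the exact total: class W is the loop invariant (`compress_isWeakExpansion` after
every FAST-EXPANSION-SUM, whose class-W inputs make it exact and nonoverlapping by Theorem 1,
`fastExpansionSum_nonoverlapping_of_isWeakExpansion`).  Without the intermediate COMPRESS the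
loop is NOT valid under ties-to-away (FAST-EXPANSION-SUM can leave class W there,
`WeakExpansion.lean` (b)). [cite: Shewchuk1997, Thm 13 p. 321, Thm 23 p. 331, §2.8] -/
theorem compressAccumulate_spec (hp : 4 ≤ p) (hfl : IsRoundNearest p emin fl) :
    ∀ es : List (List ℚ), (∀ e ∈ es, (∀ x ∈ e, IsFloat p emin x) ∧ IsExpansion 1 e) →
      IsWeakExpansion (compressAccumulate fl es) ∧
        (∀ x ∈ compressAccumulate fl es, IsFloat p emin x) ∧
        (compressAccumulate fl es).sum = (es.map List.sum).sum
  | [], _ => ⟨isWeakExpansion_nil, by simp [compressAccumulate], by simp [compressAccumulate]⟩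
  | e :: es, h => by
    obtain ⟨ihW, ihF, ihS⟩ :=
      compressAccumulate_spec hp hfl es fun e' he' => h e' (List.mem_cons_of_mem _ he')
    obtain ⟨heF, hexp⟩ := h e (by simp)
    have hp2 : 2 ≤ p := by omega
    have hp3 : 3 ≤ p := by omega
    have oc := compress_nonoverlapping hp2 hfl heF hexp
    obtain ⟨h1, h2, -, h4⟩ := fastExpansionSum_nonoverlapping_of_isWeakExpansion hp hfl
      oc.floats (compress_isWeakExpansion hp3 hfl heF hexp) ihF ihW
    have oc₂ := compress_nonoverlapping hp2 hfl h4 h1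
    refine ⟨compress_isWeakExpansion hp3 hfl h4 h1, oc₂.floats, ?_⟩
    rw [compressAccumulate, oc₂.sum_eq, h2, oc.sum_eq, ihS, List.map_cons, List.sum_cons]

end Summit.Ventures.CertifiedArithmetic.Expansions
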